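import Literature.Topology.PlanarFoliations.FrontierLeaves
import HarnessLib

/-!
# Reversing the tangential orientation: α-limit sets

Topic: Topology / PlanarFoliations, sequel to `BiOrient.lean`, `LeafOrder.lean`,
`OmegaLimit.lean`, `FrontierLeaves.lean`. The forward half-leaves, ω-limit sets and the
monotonicity / Poincaré–Bendixson theorems of the preceding files refer to the linear order
`leafLT hbi` of an open leaf determined by a bi-orientation `hbi`. Reversing the leaf
coordinate of every flow box (`flipChart`) gives the **flipped foliation** `F.flip`: the same
plaques, leaves, leaf topology and transverse orientation, again bi-oriented, whose leaf order
is the **reverse** order (`leafLT_flip_iff`). Every ω-statement therefore has an α-version,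
obtained by applying it to `F.flip`; we record the dictionary and the α-versions of the main
theorems.

* `Foliation.flip` (**definition**); `samePlaque_flip_iff`, `leaf_flip`, `leafTopology_flip`,
  `isTransverselyOriented_flip`, `isBiOriented_flip` (**proved**).
* `leafSpaceFlip : F.LeafSpace ≃ₜ F.flip.LeafSpace`, `Leaf.toFlip : F.Leaf x ≃ₜ F.flip.Leaf x`
  (**definitions**, the identity maps).
* `leafLT_flip_iff` (**proved**): `toFlip p < toFlip q ↔ q < p` — locally the flipped flow box
  reads the order (`leafArc_lt_iff`), globally the two rays from `p` are the two halves of the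
  punctured leaf (connectedness).
* `bwd`, `alphaSet` (**definitions**): backward half-leaves and the α-limit set, equal to the
  forward half-leaves and the ω-limit set of `F.flip` (`fwd_flip`, `omegaSet_flip`).
* α-versions (**proved**): `not_mem_alphaSet_self`, `alphaSet_vert_subsingleton`,
  `not_mem_alphaSet_of_mem_alphaSet`, `not_mem_alphaSet_of_subset_closure`, and the mixed
  statements `not_mem_alphaSet_of_mem_omegaSet`, `not_mem_omegaSet_of_mem_alphaSet` (an ω-limit
  leaf does not α-accumulate in the domain and vice versa); `alphaSet_flip` (α of the flip is ω).

All statements are [folklore].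
-/

noncomputable section

open Set Filter Function
open _root_.Topology
open Literature.Topology.FourManifolds Literature.Topology.FourManifolds.Foliation
  Literature.Topology.FourManifolds.OneManifold Literature.Topology.PlaneTopology

namespace Literature.Topology.PlanarFoliations

variable {X : Type*} [TopologicalSpace X]

/-! ## Flipped boxes -/

/-- Flipping twice gives the box back. [folklore] -/
@[simp] theorem flipChart_flipChart (e : OpenPartialHomeomorph X (ℝ × ℝ)) : flipChart (flipChart e) = e := by
  ext y <;> simp [flipChart]

/-- The plaques of the flipped box are those of the box. [folklore] -/
@[simp] theorem plaque_flipChart (e : OpenPartialHomeomorph X (ℝ × ℝ)) (t : ℝ) : plaque (flipChart e) t = plaque e t := by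
  ext y
  exact Iff.rfl

end Literature.Topology.PlanarFoliations

/-! ## The flipped foliation -/

namespace Literature.Topology.FourManifolds.Foliation

open Literature.Topology.PlanarFoliations

variable {X : Type*} [TopologicalSpace X]

/-- Two foliations with the same atlas are equal. [folklore] -/
theorem ext_atlas {B : Type*} [TopologicalSpace B] {F G : Foliation B X} (h : F.atlas = G.atlas) : F = G := by
  cases F
  cases G
  cases h
  rfl

variable (F : Foliation ℝ X)

/-- **The flipped foliation**: every flow box with its leaf coordinate reversed. [folklore] -/
def flip : Foliation ℝ X where
  atlas := flipChart '' F.atlas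
  target_eq := by
    rintro _ ⟨e, he, rfl⟩
    exact flipChart_target (F.target_eq e he)
  exists_mem_source x := by
    obtain ⟨e, he, hx⟩ := F.exists_mem_source x
    exact ⟨flipChart e, mem_image_of_mem _ he, hx⟩
  locally_plaque := by
    rintro _ ⟨e, he, rfl⟩ _ ⟨e', he', rfl⟩ x hx
    exact F.locally_plaque e he e' he' x hx

variable {F}

/-- The boxes of the flipped foliation. [folklore] -/
theorem mem_flip_atlas_iff {d : OpenPartialHomeomorph X (ℝ × ℝ)} : d ∈ F.flip.atlas ↔ ∃ e ∈ F.atlas, flipChart e = d :=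
  Iff.rfl

/-- The flip of a box of the atlas is a box of the flipped atlas. [folklore] -/
theorem flipChart_mem_flip {e : OpenPartialHomeomorph X (ℝ × ℝ)} (he : e ∈ F.atlas) : flipChart e ∈ F.flip.atlas :=
  mem_image_of_mem _ he

/-- A box of the flipped atlas is the flip of a box of the atlas. [folklore] -/
theorem flipChart_mem_of_mem_flip {d : OpenPartialHomeomorph X (ℝ × ℝ)} (hd : d ∈ F.flip.atlas) : flipChart d ∈ F.atlas := by
  obtain ⟨e, he, rfl⟩ := hd
  rwa [flipChart_flipChart]

/-- Flipping twice gives the foliation back. [folklore] -/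
@[simp] theorem flip_flip : F.flip.flip = F :=
  ext_atlas (by
    show flipChart '' (flipChart '' F.atlas) = F.atlas
    rw [image_image]
    simp)

/-- **The flipped foliation has the same plaque relation.** [folklore] -/
theorem samePlaque_flip_iff {x y : X} : F.flip.SamePlaque x y ↔ F.SamePlaque x y := by
  constructor
  · rintro ⟨_, ⟨e, he, rfl⟩, hx, hy, h⟩
    exact ⟨e, he, hx, hy, h⟩
  · rintro ⟨e, he, hx, hy, h⟩
    exact ⟨flipChart e, mem_image_of_mem _ he, hx, hy, h⟩

/-- **The flipped foliation has the same leaves.** [folklore] -/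
@[simp] theorem leaf_flip (x : X) : F.flip.leaf x = F.leaf x := by
  ext y
  rw [Foliation.mem_leaf_iff, Foliation.mem_leaf_iff]
  have h : F.flip.SamePlaque = F.SamePlaque := by
    funext a b
    exact propext samePlaque_flip_iff
  rw [h]

/-- **The flipped foliation has the same leaf topology** (the plaque maps of the flipped boxes
are those of the boxes composed with the reflection of the line). [folklore] -/
theorem leafTopology_flip : F.flip.leafTopology = F.leafTopology := by
  have hpm : ∀ (e : OpenPartialHomeomorph X (ℝ × ℝ)) (t : ℝ),
      plaqueMap (flipChart e) t = plaqueMap e t ∘ (Homeomorph.neg ℝ) := fun e t ↦ by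
    funext b
    rfl
  show (⨆ e ∈ F.flip.atlas, ⨆ t : ℝ, TopologicalSpace.coinduced (plaqueMap e t) inferInstance) =
    ⨆ e ∈ F.atlas, ⨆ t : ℝ, TopologicalSpace.coinduced (plaqueMap e t) inferInstance
  rw [show F.flip.atlas = flipChart '' F.atlas from rfl, iSup_image]
  refine iSup_congr fun e ↦ iSup_congr fun _ ↦ iSup_congr fun t ↦ ?_
  rw [hpm, ← coinduced_compose, (Homeomorph.neg ℝ).coinduced_eq]

/-- **The flipped foliation is transversely oriented** when `F` is. [folklore] -/
theorem isTransverselyOriented_flip (ho : F.IsTransverselyOriented) : F.flip.IsTransverselyOriented := by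
  rintro _ ⟨e, he, rfl⟩ _ ⟨e', he', rfl⟩ x hx
  exact ho e he e' he' x hx

/-- **The flipped foliation is bi-oriented** when `F` is. [folklore] -/
theorem isBiOriented_flip (hbi : IsBiOriented F) : IsBiOriented F.flip := by
  rintro _ ⟨e, he, rfl⟩ _ ⟨e', he', rfl⟩ x hx
  obtain ⟨U, hU, h⟩ := hbi e he e' he' x hx
  refine ⟨U, hU, fun y hy z hz hyz hlt ↦ ?_⟩
  simp only [flipChart_apply, neg_lt_neg_iff] at hyz hlt ⊢
  exact h z hz y hy hyz.symm hlt

/-! ## The leaf spaces and leaves of `F` and `F.flip` -/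

/-- **The identity `M^δ_F ≃ M^δ_{F.flip}`** is a homeomorphism. [folklore] -/
def leafSpaceFlip : F.LeafSpace ≃ₜ F.flip.LeafSpace where
  toEquiv := (toLeafSpace (F := F)).symm.trans (toLeafSpace (F := F.flip))
  continuous_toFun := by
    have key : @Continuous X X F.leafTopology F.flip.leafTopology id := by
      rw [leafTopology_flip]
      exact @continuous_id X F.leafTopology
    exact key
  continuous_invFun := by
    have key : @Continuous X X F.flip.leafTopology F.leafTopology id := by
      rw [leafTopology_flip]
      exact @continuous_id X F.leafTopology
    exact key

/-- The identity of leaf spaces on points. [folklore] -/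
@[simp] theorem ofLeafSpace_leafSpaceFlip (p : F.LeafSpace) :
    ofLeafSpace (leafSpaceFlip p : F.flip.LeafSpace) = ofLeafSpace p := rfl

/-- The identity of leaf spaces on points. [folklore] -/
@[simp] theorem ofLeafSpace_leafSpaceFlip_symm (p : F.flip.LeafSpace) :
    ofLeafSpace ((leafSpaceFlip (F := F)).symm p) = ofLeafSpace p := rfl

/-- The identity of leaf spaces on points. [folklore] -/
@[simp] theorem leafSpaceFlip_toLeafSpace (y : X) :
    leafSpaceFlip (toLeafSpace y : F.LeafSpace) = (toLeafSpace y : F.flip.LeafSpace) := rfl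

/-- **The identity `F.Leaf x ≃ F.flip.Leaf x`** is a homeomorphism. [folklore] -/
def Leaf.toFlip (x : X) : F.Leaf x ≃ₜ F.flip.Leaf x :=
  (leafSpaceFlip (F := F)).subtype fun p ↦ by
    show ofLeafSpace p ∈ F.leaf x ↔ ofLeafSpace (leafSpaceFlip p : F.flip.LeafSpace) ∈ F.flip.leaf x
    rw [leaf_flip]
    rfl

/-- The identity of leaves on points. [folklore] -/
@[simp] theorem ofLeafSpace_toFlip {x : X} (p : F.Leaf x) :
    ofLeafSpace ((Leaf.toFlip x p : F.flip.Leaf x) : F.flip.LeafSpace) = ofLeafSpace (p : F.LeafSpace) := rfl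

/-- The identity of leaves on points. [folklore] -/
@[simp] theorem ofLeafSpace_toFlip_symm {x : X} (p : F.flip.Leaf x) :
    ofLeafSpace (((Leaf.toFlip x).symm p : F.Leaf x) : F.LeafSpace) = ofLeafSpace (p : F.flip.LeafSpace) := rfl

/-- Open leaves stay open. [folklore] -/
instance instNoncompactSpaceLeafFlip {x : X} [NoncompactSpace (F.Leaf x)] : NoncompactSpace (F.flip.Leaf x) :=
  (Leaf.toFlip (F := F) x).isClosedEmbedding.noncompactSpace

end Literature.Topology.FourManifolds.Foliation

/-! ## The flipped leaf order is the reverse order -/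

namespace Literature.Topology.PlanarFoliations

variable {X : Type*} [TopologicalSpace X] [T2Space X] [SecondCountableTopology X] {F : Foliation ℝ X} {x : X}
variable [NoncompactSpace (F.Leaf x)] {hbi : IsBiOriented F}
variable {e : OpenPartialHomeomorph X (ℝ × ℝ)} {u₀ : ℝ} {ι : X → ℂ}

/-- Forward rays are preconnected. [folklore] -/
theorem isPreconnected_setOf_leafLT_right (r : F.Leaf x) : IsPreconnected {s | leafLT hbi r s} := by
  refine isPreconnected_of_forall_pair fun a ha b hb ↦ ?_
  rcases leafLT_trichotomy (hbi := hbi) a b with h | rfl | h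
  · refine ⟨leafIcc hbi a b, fun s hs ↦ ?_, left_mem_leafIcc (leafLT_asymm h), right_mem_leafIcc (leafLT_asymm h),
      isPreconnected_leafIcc a b⟩
    rcases not_leafLT_iff.1 hs.1 with h' | rfl
    · exact leafLT_trans ha h'
    · exact ha
  · exact ⟨{a}, by simpa using ha, rfl, rfl, isPreconnected_singleton⟩
  · refine ⟨leafIcc hbi b a, fun s hs ↦ ?_, right_mem_leafIcc (leafLT_asymm h), left_mem_leafIcc (leafLT_asymm h),
      isPreconnected_leafIcc b a⟩
    rcases not_leafLT_iff.1 hs.1 with h' | rfl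
    · exact leafLT_trans hb h'
    · exact hb

/-- Backward rays are preconnected. [folklore] -/
theorem isPreconnected_setOf_leafLT_left (r : F.Leaf x) : IsPreconnected {s | leafLT hbi s r} := by
  refine isPreconnected_of_forall_pair fun a ha b hb ↦ ?_
  rcases leafLT_trichotomy (hbi := hbi) a b with h | rfl | h
  · refine ⟨leafIcc hbi a b, fun s hs ↦ ?_, left_mem_leafIcc (leafLT_asymm h), right_mem_leafIcc (leafLT_asymm h),
      isPreconnected_leafIcc a b⟩
    rcases not_leafLT_iff.1 hs.2 with h' | rfl
    · exact leafLT_trans h' hb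
    · exact hb
  · exact ⟨{a}, by simpa using ha, rfl, rfl, isPreconnected_singleton⟩
  · refine ⟨leafIcc hbi b a, fun s hs ↦ ?_, right_mem_leafIcc (leafLT_asymm h), left_mem_leafIcc (leafLT_asymm h),
      isPreconnected_leafIcc b a⟩
    rcases not_leafLT_iff.1 hs.2 with h' | rfl
    · exact leafLT_trans h' ha
    · exact ha

/-- **Locally, the flipped order is the reverse order**: for two points on the plaque of a flow
box of the atlas, read by the flipped box. [folklore] -/
theorem leafLT_flip_iff_of_mem_plaque (he : e ∈ F.atlas) {t : ℝ} (h : plaque e t ⊆ F.leaf x) {p q : F.Leaf x}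
    (hp : Leaf.pt p ∈ plaque e t) (hq : Leaf.pt q ∈ plaque e t) :
    leafLT (isBiOriented_flip hbi) (Leaf.toFlip x p) (Leaf.toFlip x q) ↔ leafLT hbi q p := by
  -- read by `e` in `F`
  have hps : p ∈ (leafArc e t h he).source := (mem_leafArc_source_iff h he).2 hp
  have hqs : q ∈ (leafArc e t h he).source := (mem_leafArc_source_iff h he).2 hq
  have h₁ := leafArc_lt_iff (hbi := hbi) he h hqs hps
  rw [leafArc_apply h he hqs, leafArc_apply h he hps] at h₁
  -- read by `flipChart e` in `F.flip`
  have he' : flipChart e ∈ F.flip.atlas := flipChart_mem_flip he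
  have h' : plaque (flipChart e) t ⊆ F.flip.leaf x := by rw [plaque_flipChart, leaf_flip]; exact h
  have hps' : Leaf.toFlip x p ∈ (leafArc (flipChart e) t h' he').source :=
    (mem_leafArc_source_iff h' he').2 (by rw [plaque_flipChart]; exact hp)
  have hqs' : Leaf.toFlip x q ∈ (leafArc (flipChart e) t h' he').source :=
    (mem_leafArc_source_iff h' he').2 (by rw [plaque_flipChart]; exact hq)
  have h₂ := leafArc_lt_iff (hbi := isBiOriented_flip hbi) he' h' hps' hqs'
  rw [leafArc_apply h' he' hps', leafArc_apply h' he' hqs'] at h₂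
  rw [← h₂, ← h₁]
  show -(e (Leaf.pt p)).1 < -(e (Leaf.pt q)).1 ↔ (e (Leaf.pt q)).1 < (e (Leaf.pt p)).1
  exact neg_lt_neg_iff

/-- **The flipped order is the reverse order.** [folklore] -/
theorem leafLT_flip_iff (p q : F.Leaf x) :
    leafLT (isBiOriented_flip hbi) (Leaf.toFlip x p) (Leaf.toFlip x q) ↔ leafLT hbi q p := by
  set hbi' := isBiOriented_flip hbi
  set φ := Leaf.toFlip (F := F) x with hφ
  -- the four rays from `p`
  set R : Set (F.Leaf x) := {s | leafLT hbi p s} with hR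
  set L : Set (F.Leaf x) := {s | leafLT hbi s p} with hL
  set R' : Set (F.Leaf x) := {s | leafLT hbi' (φ p) (φ s)} with hR'
  set L' : Set (F.Leaf x) := {s | leafLT hbi' (φ s) (φ p)} with hL'
  have hRo : IsOpen R := isOpen_setOf_leafLT_right p
  have hLo : IsOpen L := isOpen_setOf_leafLT_left p
  have hRL : Disjoint R L := disjoint_left.2 fun s h₁ h₂ ↦ leafLT_asymm h₁ h₂
  -- `R'`, `L'` are preimages of the rays of `F.flip`: preconnected, inside `R ∪ L`
  have hR'c : IsPreconnected R' := by
    have h := (isPreconnected_setOf_leafLT_right (hbi := hbi') (φ p)).image φ.symm φ.symm.continuous.continuousOn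
    convert h using 1
    ext s
    simp only [hR', mem_setOf_eq, mem_image]
    constructor
    · exact fun hs ↦ ⟨φ s, hs, φ.symm_apply_apply s⟩
    · rintro ⟨s', hs', rfl⟩
      rwa [φ.apply_symm_apply]
  have hL'c : IsPreconnected L' := by
    have h := (isPreconnected_setOf_leafLT_left (hbi := hbi') (φ p)).image φ.symm φ.symm.continuous.continuousOn
    convert h using 1
    ext s
    simp only [hL', mem_setOf_eq, mem_image]
    constructor
    · exact fun hs ↦ ⟨φ s, hs, φ.symm_apply_apply s⟩
    · rintro ⟨s', hs', rfl⟩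
      rwa [φ.apply_symm_apply]
  have hne : ∀ {s}, s ≠ p → s ∈ R ∪ L := fun {s} hs ↦ by
    rcases leafLT_trichotomy (hbi := hbi) p s with h | h | h
    · exact Or.inl h
    · exact absurd h.symm hs
    · exact Or.inr h
  have hR'sub : R' ⊆ R ∪ L := fun s hs ↦ hne fun h ↦ by rw [h] at hs; exact leafLT_irrefl _ hs
  have hL'sub : L' ⊆ R ∪ L := fun s hs ↦ hne fun h ↦ by rw [h] at hs; exact leafLT_irrefl _ hs
  -- locally near `p` the flipped order is reversed: `R'` meets `L` and `L'` meets `R`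
  obtain ⟨e, he, hpe⟩ := F.exists_mem_source (Leaf.pt p)
  set t := (e (Leaf.pt p)).2
  have hP : plaque e t ⊆ F.leaf x := F.plaque_subset_leaf_of_mem he p.2 (mem_plaque_self hpe)
  have hsrc : (leafArc e t hP he).source ∈ 𝓝 p :=
    (leafArc e t hP he).open_source.mem_nhds ((mem_leafArc_source_iff hP he).2 (mem_plaque_self hpe))
  have hloc : ∀ s ∈ (leafArc e t hP he).source, (s ∈ R' ↔ s ∈ L) ∧ (s ∈ L' ↔ s ∈ R) := fun s hs ↦
    ⟨leafLT_flip_iff_of_mem_plaque he hP (mem_plaque_self hpe) ((mem_leafArc_source_iff hP he).1 hs),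
      leafLT_flip_iff_of_mem_plaque he hP ((mem_leafArc_source_iff hP he).1 hs) (mem_plaque_self hpe)⟩
  obtain ⟨s₁, hs₁L, hs₁src⟩ := ((frequently_leafLT_left (hbi := hbi) p).and_eventually hsrc).exists
  obtain ⟨s₂, hs₂R, hs₂src⟩ := ((frequently_leafLT_right (hbi := hbi) p).and_eventually hsrc).exists
  have hs₁R' : s₁ ∈ R' := (hloc s₁ hs₁src).1.2 hs₁L
  have hs₂L' : s₂ ∈ L' := (hloc s₂ hs₂src).2.2 hs₂R
  -- hence `R' ⊆ L` and `L' ⊆ R`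
  have hR'L : R' ⊆ L := by
    rcases hR'c.subset_or_subset hRo hLo hRL hR'sub with h | h
    · exact absurd (h hs₁R') (disjoint_right.1 hRL hs₁L)
    · exact h
  have hL'R : L' ⊆ R := by
    rcases hL'c.subset_or_subset hRo hLo hRL hL'sub with h | h
    · exact h
    · exact absurd (h hs₂L') (disjoint_left.1 hRL hs₂R)
  -- conclusion
  change q ∈ R' ↔ q ∈ L
  refine ⟨fun h ↦ hR'L h, fun h ↦ ?_⟩
  have hqp : q ≠ p := fun h' ↦ by rw [h'] at h; exact leafLT_irrefl _ h
  have hq' : φ q ≠ φ p := fun h' ↦ hqp (φ.injective h')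
  rcases leafLT_trichotomy (hbi := hbi') (φ p) (φ q) with h' | h' | h'
  · exact h'
  · exact absurd h'.symm hq'
  · exact absurd h (disjoint_left.1 hRL (hL'R h'))

/-! ## Backward half-leaves and the α-limit set -/

variable (hbi) in
/-- **The backward half-leaf** from `p`: the points `q ≤ p` of the open leaf. [folklore] -/
def bwd (p : F.Leaf x) : Set (F.Leaf x) := {q | ¬ leafLT hbi p q}

/-- `p` is in its backward half-leaf. [folklore] -/
theorem mem_bwd_self (p : F.Leaf x) : p ∈ bwd hbi p := leafLT_irrefl p

/-- **Backward half-leaves are the forward half-leaves of the flipped foliation.** [folklore] -/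
theorem toFlip_mem_fwd_iff (p q : F.Leaf x) :
    Leaf.toFlip x q ∈ fwd (isBiOriented_flip hbi) (Leaf.toFlip x p) ↔ q ∈ bwd hbi p := by
  show ¬ leafLT (isBiOriented_flip hbi) (Leaf.toFlip x q) (Leaf.toFlip x p) ↔ ¬ leafLT hbi p q
  rw [leafLT_flip_iff]

/-- The forward half-leaf of the flipped foliation is the image of the backward half-leaf.
[folklore] -/
theorem fwd_flip_eq_image (p : F.Leaf x) :
    fwd (isBiOriented_flip hbi) (Leaf.toFlip x p) = Leaf.toFlip x '' bwd hbi p := by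
  ext s
  constructor
  · intro hs
    refine ⟨(Leaf.toFlip x).symm s, ?_, (Leaf.toFlip x).apply_symm_apply s⟩
    rw [← toFlip_mem_fwd_iff, (Leaf.toFlip x).apply_symm_apply]
    exact hs
  · rintro ⟨q, hq, rfl⟩
    exact (toFlip_mem_fwd_iff p q).2 hq

/-- **The α-limit set** of the open leaf `F.Leaf x` in the plane: the points of `ℂ` approached
by every backward half-leaf. [folklore] -/
def alphaSet (hbi : IsBiOriented F) (ι : X → ℂ) (x : X) [NoncompactSpace (F.Leaf x)] : Set ℂ :=
  ⋂ p : F.Leaf x, closure ((fun q : F.Leaf x ↦ ι (Leaf.pt q)) '' bwd hbi p)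

/-- Membership in the α-limit set. [folklore] -/
theorem mem_alphaSet_iff {z : ℂ} :
    z ∈ alphaSet hbi ι x ↔ ∀ p : F.Leaf x, z ∈ closure ((fun q : F.Leaf x ↦ ι (Leaf.pt q)) '' bwd hbi p) := mem_iInter

/-- **The α-limit set is the ω-limit set of the flipped foliation.** [folklore] -/
theorem alphaSet_eq_omegaSet_flip : alphaSet hbi ι x = omegaSet (isBiOriented_flip hbi) ι x := by
  unfold alphaSet omegaSet
  refine iInter_congr_of_surjective (Leaf.toFlip x) (Leaf.toFlip x).surjective fun p ↦ ?_
  rw [fwd_flip_eq_image, image_image]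
  rfl

/-- **Forward half-leaves are the backward half-leaves of the flipped foliation.** [folklore] -/
theorem toFlip_mem_bwd_iff (p q : F.Leaf x) :
    Leaf.toFlip x q ∈ bwd (isBiOriented_flip hbi) (Leaf.toFlip x p) ↔ q ∈ fwd hbi p := by
  show ¬ leafLT (isBiOriented_flip hbi) (Leaf.toFlip x p) (Leaf.toFlip x q) ↔ ¬ leafLT hbi q p
  rw [leafLT_flip_iff]

/-- The backward half-leaf of the flipped foliation is the image of the forward half-leaf.
[folklore] -/
theorem bwd_flip_eq_image (p : F.Leaf x) :
    bwd (isBiOriented_flip hbi) (Leaf.toFlip x p) = Leaf.toFlip x '' fwd hbi p := by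
  ext s
  constructor
  · intro hs
    refine ⟨(Leaf.toFlip x).symm s, ?_, (Leaf.toFlip x).apply_symm_apply s⟩
    rw [← toFlip_mem_bwd_iff, (Leaf.toFlip x).apply_symm_apply]
    exact hs
  · rintro ⟨q, hq, rfl⟩
    exact (toFlip_mem_bwd_iff p q).2 hq

/-- **The α-limit set of the flipped foliation is the ω-limit set.** [folklore] -/
theorem alphaSet_flip : alphaSet (isBiOriented_flip hbi) ι x = omegaSet hbi ι x := by
  unfold alphaSet omegaSet
  symm
  refine iInter_congr_of_surjective (Leaf.toFlip x) (Leaf.toFlip x).surjective fun p ↦ ?_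
  rw [bwd_flip_eq_image, image_image]
  rfl

/-- The α-limit set of a leaf lying in `ω(L)` lies in `ω(L)`. [folklore] -/
theorem alphaSet_subset_of_mem_omegaSet (hι : IsOpenEmbedding ι) {y : X} [NoncompactSpace (F.Leaf y)]
    (hy : ι y ∈ omegaSet hbi ι x) : alphaSet hbi ι y ⊆ omegaSet hbi ι x := by
  intro w hw
  have hcl : w ∈ closure ((fun q : F.Leaf y ↦ ι (Leaf.pt q)) '' bwd hbi (Leaf.base F y)) := (mem_alphaSet_iff.1 hw) _
  refine (isClosed_omegaSet.closure_subset_iff.2 ?_) hcl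
  rintro _ ⟨q, -, rfl⟩
  exact mem_omegaSet_of_mem_leaf hι hy q.2

/-- A crossing near an α-limit point on a vertical (the flipped `exists_crossing_near₀`).
[folklore] -/
theorem exists_crossing_near₀_alpha (he : e ∈ F.atlas) (hι : IsOpenEmbedding ι) {s : ℝ}
    (hy : ι (e.symm (u₀, s)) ∈ alphaSet hbi ι x) {ε : ℝ} (hε : 0 < ε) :
    ∃ c : F.Leaf x, IsCrossing e u₀ c ∧ |ht e c - s| < ε := by
  rw [alphaSet_eq_omegaSet_flip] at hy
  have hy' : ι ((flipChart e).symm (-u₀, s)) ∈ omegaSet (isBiOriented_flip hbi) ι x := by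
    rw [flipChart_symm_apply, neg_neg]; exact hy
  obtain ⟨c', hc', hlt⟩ := exists_crossing_near₀ (flipChart_mem_flip he) hι hy' hε
  refine ⟨(Leaf.toFlip x).symm c', ⟨hc'.1, ?_⟩, hlt⟩
  have h := hc'.2
  rw [flipChart_apply, neg_eq_iff_eq_neg, neg_neg] at h
  exact h

/-- The α-limit set is closed. [folklore] -/
theorem isClosed_alphaSet : IsClosed (alphaSet hbi ι x) := isClosed_iInter fun _ ↦ isClosed_closure

/-! ## α-versions of the Poincaré–Bendixson theorems -/

/-- **An open leaf does not α-accumulate on itself.** [folklore] -/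
theorem not_mem_alphaSet_self (hbi : IsBiOriented F) (hι : IsOpenEmbedding ι) (q : F.Leaf x) :
    ι (Leaf.pt q) ∉ alphaSet hbi ι x := by
  rw [alphaSet_eq_omegaSet_flip]
  exact not_mem_omegaSet_self (isBiOriented_flip hbi) hι (Leaf.toFlip x q)

/-- Membership in the α-limit set is a property of the leaf. [folklore] -/
theorem mem_alphaSet_of_mem_leaf (hι : IsOpenEmbedding ι) {y y' : X} (hy : ι y ∈ alphaSet hbi ι x)
    (hy' : y' ∈ F.leaf y) : ι y' ∈ alphaSet hbi ι x := by
  rw [alphaSet_eq_omegaSet_flip] at hy ⊢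
  exact mem_omegaSet_of_mem_leaf hι hy (by rw [leaf_flip]; exact hy')

/-- **A regular ω-limit leaf does not α-accumulate in the domain**: for an open leaf `L_y` in
`ω(L)`, no point of `X` lies in `α(L_y)` (its backward crossings near such a point would be
points of `ω(L)` on one vertical, hence the point itself, and `L_y` would α-accumulate on
itself). [folklore] -/
theorem not_mem_alphaSet_of_mem_omegaSet (hι : IsOpenEmbedding ι) {y : X} [NoncompactSpace (F.Leaf y)]
    (hy : ι y ∈ omegaSet hbi ι x) (y' : X) : ι y' ∉ alphaSet hbi ι y := by
  intro hy'
  have hsub := alphaSet_subset_of_mem_omegaSet (hbi := hbi) hι hy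
  have hy'L : ι y' ∈ omegaSet hbi ι x := hsub hy'
  obtain ⟨e, he, hy'e⟩ := F.exists_mem_source y'
  set u₀ := (e y').1 with hu₀
  set s' := (e y').2 with hs'
  have hy'eq : y' = e.symm (u₀, s') := by rw [show (u₀, s') = e y' from rfl, e.left_inv hy'e]
  rw [hy'eq] at hy' hy'L
  obtain ⟨c, hc, -⟩ := exists_crossing_near₀_alpha (hbi := hbi) (x := y) he hι hy' one_pos
  have hcω : ι (e.symm (u₀, ht e c)) ∈ omegaSet hbi ι x := by
    rw [← hc.pt_eq]; exact mem_omegaSet_of_mem_leaf hι hy c.2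
  have hts : ht e c = s' := omegaSet_vert_subsingleton (hbi := hbi) he hι hcω hy'L
  have hcy' : ι (Leaf.pt c) = ι (e.symm (u₀, s')) := by rw [hc.pt_eq, hts]
  exact not_mem_alphaSet_self hbi hι c (hcy' ▸ hy')

/-- **A regular α-limit leaf does not ω-accumulate in the domain.** [folklore] -/
theorem not_mem_omegaSet_of_mem_alphaSet (hι : IsOpenEmbedding ι) {y : X} [NoncompactSpace (F.Leaf y)]
    (hy : ι y ∈ alphaSet hbi ι x) (y' : X) : ι y' ∉ omegaSet hbi ι y := by
  rw [alphaSet_eq_omegaSet_flip] at hy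
  have h := not_mem_alphaSet_of_mem_omegaSet (hbi := isBiOriented_flip hbi) hι hy y'
  rwa [alphaSet_flip] at h

/-- **The α-limit set of an open leaf meets each vertical of a flow box in at most one point.**
[folklore] -/
theorem alphaSet_vert_subsingleton (he : e ∈ F.atlas) (hι : IsOpenEmbedding ι) {s₁ s₂ : ℝ}
    (h₁ : ι (e.symm (u₀, s₁)) ∈ alphaSet hbi ι x) (h₂ : ι (e.symm (u₀, s₂)) ∈ alphaSet hbi ι x) : s₁ = s₂ := by
  rw [alphaSet_eq_omegaSet_flip] at h₁ h₂
  have h₁' : ι ((flipChart e).symm (-u₀, s₁)) ∈ omegaSet (isBiOriented_flip hbi) ι x := by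
    rw [flipChart_symm_apply, neg_neg]; exact h₁
  have h₂' : ι ((flipChart e).symm (-u₀, s₂)) ∈ omegaSet (isBiOriented_flip hbi) ι x := by
    rw [flipChart_symm_apply, neg_neg]; exact h₂
  exact omegaSet_vert_subsingleton (flipChart_mem_flip he) hι h₁' h₂'

/-- **A regular α-limit leaf with a regular α-limit point of its own is compact**: for an open
leaf `L_y` in `α(L)`, no point of `X` lies in `α(L_y)`. [folklore] -/
theorem not_mem_alphaSet_of_mem_alphaSet (hι : IsOpenEmbedding ι) {y : X} [NoncompactSpace (F.Leaf y)]
    (hy : ι y ∈ alphaSet hbi ι x) (y' : X) : ι y' ∉ alphaSet hbi ι y := by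
  rw [alphaSet_eq_omegaSet_flip] at hy ⊢
  exact not_mem_omegaSet_of_mem_omegaSet hι hy y'

/-- **The α-limit set of an open leaf in the closure of a set of compact leaves contains no point
of the domain.** [folklore] -/
theorem not_mem_alphaSet_of_subset_closure (hι : IsOpenEmbedding ι) {V : Set X}
    (hVc : ∀ v ∈ V, IsCompact (F.leaf v)) (hL : F.leaf x ⊆ closure V) (z : X) :
    ι z ∉ alphaSet hbi ι x := by
  rw [alphaSet_eq_omegaSet_flip]
  exact not_mem_omegaSet_of_subset_closure hι (fun v hv ↦ by rw [leaf_flip]; exact hVc v hv)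
    (by rw [leaf_flip]; exact hL) z

end Literature.Topology.PlanarFoliations
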